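import Mathlib.Analysis.Complex.Basic
import Mathlib.Algebra.MvPolynomial.Eval
import Mathlib.Topology.Algebra.MvPolynomial
import Mathlib.Analysis.Normed.Ring.Lemmas
import HarnessLib

/-!
# Polynomial growth and local Lipschitz bounds for complex polynomials in several variables

Layer `Literature/Analysis/Complex`. Two elementary estimates for `δ ∈ ℂ[X_i : i ∈ ι]` (`ι` finite,
`ℂ^ι` with the sup norm), used to control the size of the balls in `{δ ≠ 0}` around a point `z` in
terms of `|δ(z)|` and `|z|` (SGA 1 XII Thm. 5.1, proof, part 2: polynomial growth of the
transcendental separating function towards the branch hypersurface):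

* `MvPolynomial.exists_norm_eval_le_pow` — `|δ(w)| ≤ C (1 + |w|)^k`;
* `MvPolynomial.exists_norm_eval_sub_le` — `|δ(w) - δ(z)| ≤ C (1 + |z|)^k |w - z|` for `|w - z| ≤ 2`;
* `MvPolynomial.exists_radius` — a radius `ρ(z) ∈ (0, 1]` with `B(z, 2ρ(z)) ⊆ {δ ≠ 0}` and
  `ρ(z)⁻¹ ≤ C (1 + |z|)^k / |δ(z)|`.

Everything is proved by induction on `δ`; no named facts.

## References

* A. Grothendieck, M. Raynaud, *SGA 1*, Exp. XII Thm. 5.1 (proof, part 2). [SGA1]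

#harness_tags complex_analysis.several_variables, complex_geometry.riemann_existence
-/

noncomputable section

open Set Metric

namespace MvPolynomial

variable {ι : Type*} [Fintype ι]

/-- `(1 + |z|)^a ≤ (1 + |z|)^b` for `a ≤ b`. [folklore] -/
theorem one_add_norm_pow_le_pow {E : Type*} [SeminormedAddCommGroup E] (z : E) {a b : ℕ} (h : a ≤ b) :
    (1 + ‖z‖) ^ a ≤ (1 + ‖z‖) ^ b :=
  pow_le_pow_right₀ (by linarith [norm_nonneg z]) h

/-- **Polynomial growth of a polynomial**: `|δ(w)| ≤ C (1 + |w|)^k`. [folklore] -/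
theorem exists_norm_eval_le_pow (δ : MvPolynomial ι ℂ) :
    ∃ C : ℝ, 0 < C ∧ ∃ k : ℕ, ∀ w : ι → ℂ, ‖eval w δ‖ ≤ C * (1 + ‖w‖) ^ k := by
  induction δ using MvPolynomial.induction_on with
  | C c =>
    refine ⟨‖c‖ + 1, by positivity, 0, fun w ↦ ?_⟩
    rw [eval_C, pow_zero, mul_one]; linarith
  | add p q hp hq =>
    obtain ⟨C₁, hC₁, k₁, h₁⟩ := hp
    obtain ⟨C₂, hC₂, k₂, h₂⟩ := hq
    refine ⟨C₁ + C₂, by positivity, max k₁ k₂, fun w ↦ ?_⟩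
    rw [map_add]
    refine (norm_add_le _ _).trans ?_
    have e1 := (h₁ w).trans (mul_le_mul_of_nonneg_left (one_add_norm_pow_le_pow w (le_max_left k₁ k₂)) hC₁.le)
    have e2 := (h₂ w).trans (mul_le_mul_of_nonneg_left (one_add_norm_pow_le_pow w (le_max_right k₁ k₂)) hC₂.le)
    linarith
  | mul_X p i hp =>
    obtain ⟨C, hC, k, h⟩ := hp
    refine ⟨C, hC, k + 1, fun w ↦ ?_⟩
    rw [map_mul, eval_X, norm_mul, pow_succ, ← mul_assoc]
    have hwi : ‖w i‖ ≤ 1 + ‖w‖ := (norm_le_pi_norm w i).trans (by linarith [norm_nonneg w])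
    exact mul_le_mul (h w) hwi (norm_nonneg _) (by positivity)

/-- **Local Lipschitz bound of a polynomial**: `|δ(w) - δ(z)| ≤ C (1 + |z|)^k |w - z|` for
`|w - z| ≤ 2`. [folklore] -/
theorem exists_norm_eval_sub_le (δ : MvPolynomial ι ℂ) :
    ∃ C : ℝ, 0 < C ∧ ∃ k : ℕ, ∀ z w : ι → ℂ, ‖w - z‖ ≤ 2 →
      ‖eval w δ - eval z δ‖ ≤ C * (1 + ‖z‖) ^ k * ‖w - z‖ := by
  induction δ using MvPolynomial.induction_on with
  | C c => exact ⟨1, one_pos, 0, fun z w _ ↦ by simp⟩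
  | add p q hp hq =>
    obtain ⟨C₁, hC₁, k₁, h₁⟩ := hp
    obtain ⟨C₂, hC₂, k₂, h₂⟩ := hq
    refine ⟨C₁ + C₂, by positivity, max k₁ k₂, fun z w hzw ↦ ?_⟩
    rw [map_add, map_add, add_sub_add_comm]
    refine (norm_add_le _ _).trans ?_
    have hn := norm_nonneg (w - z)
    have e1 := (h₁ z w hzw).trans (mul_le_mul_of_nonneg_right
      (mul_le_mul_of_nonneg_left (one_add_norm_pow_le_pow z (le_max_left k₁ k₂)) hC₁.le) hn)
    have e2 := (h₂ z w hzw).trans (mul_le_mul_of_nonneg_right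
      (mul_le_mul_of_nonneg_left (one_add_norm_pow_le_pow z (le_max_right k₁ k₂)) hC₂.le) hn)
    nlinarith
  | mul_X p i hp =>
    obtain ⟨C, hC, k, h⟩ := hp
    obtain ⟨C', hC', k', h'⟩ := exists_norm_eval_le_pow p
    refine ⟨C' * 3 ^ k' + C, by positivity, max k' (k + 1), fun z w hzw ↦ ?_⟩
    rw [map_mul, map_mul, eval_X, eval_X]
    have hsplit : eval w p * w i - eval z p * z i = eval w p * (w i - z i) + (eval w p - eval z p) * z i := by ring
    rw [hsplit]
    refine (norm_add_le _ _).trans ?_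
    rw [norm_mul, norm_mul]
    have hn := norm_nonneg (w - z)
    have hz0 := norm_nonneg z
    have hwz : ‖w i - z i‖ ≤ ‖w - z‖ := norm_le_pi_norm (w - z) i
    have hzi : ‖z i‖ ≤ 1 + ‖z‖ := (norm_le_pi_norm z i).trans (by linarith)
    have hw : ‖w‖ ≤ ‖z‖ + 2 := by
      have := norm_le_norm_add_norm_sub' w z
      linarith [norm_sub_rev w z]
    -- `|p(w)| ≤ C' (1 + |w|)^{k'} ≤ C' 3^{k'} (1 + |z|)^{k'}`
    have hpw : ‖eval w p‖ ≤ C' * 3 ^ k' * (1 + ‖z‖) ^ max k' (k + 1) := by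
      refine (h' w).trans ?_
      have h3 : (1 + ‖w‖) ^ k' ≤ (3 * (1 + ‖z‖)) ^ k' := pow_le_pow_left₀ (by positivity) (by linarith) _
      rw [mul_pow] at h3
      have h4 := one_add_norm_pow_le_pow z (le_max_left k' (k + 1))
      calc C' * (1 + ‖w‖) ^ k' ≤ C' * (3 ^ k' * (1 + ‖z‖) ^ k') := mul_le_mul_of_nonneg_left h3 hC'.le
        _ ≤ C' * (3 ^ k' * (1 + ‖z‖) ^ max k' (k + 1)) := by gcongr
        _ = C' * 3 ^ k' * (1 + ‖z‖) ^ max k' (k + 1) := by ring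
    -- `|p(w) - p(z)| |z_i| ≤ C (1+|z|)^k |w - z| (1 + |z|)`
    have hdiff : ‖eval w p - eval z p‖ * ‖z i‖ ≤ C * (1 + ‖z‖) ^ max k' (k + 1) * ‖w - z‖ := by
      calc ‖eval w p - eval z p‖ * ‖z i‖ ≤ (C * (1 + ‖z‖) ^ k * ‖w - z‖) * (1 + ‖z‖) :=
            mul_le_mul (h z w hzw) hzi (norm_nonneg _) (by positivity)
        _ = C * (1 + ‖z‖) ^ (k + 1) * ‖w - z‖ := by ring
        _ ≤ C * (1 + ‖z‖) ^ max k' (k + 1) * ‖w - z‖ := by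
            gcongr
            · linarith
            · exact le_max_right _ _
    calc ‖eval w p‖ * ‖w i - z i‖ + ‖eval w p - eval z p‖ * ‖z i‖
        ≤ C' * 3 ^ k' * (1 + ‖z‖) ^ max k' (k + 1) * ‖w - z‖ + C * (1 + ‖z‖) ^ max k' (k + 1) * ‖w - z‖ :=
          add_le_add (mul_le_mul hpw hwz (norm_nonneg _) (by positivity)) hdiff
      _ = (C' * 3 ^ k' + C) * (1 + ‖z‖) ^ max k' (k + 1) * ‖w - z‖ := by ring

/-- **The radius of a good ball**: for a polynomial `δ` there are `C > 0` and `k` such that every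
`z` with `δ(z) ≠ 0` is the centre of a ball `B(z, 2ρ) ⊆ {δ ≠ 0}` with `0 < ρ ≤ 1` and
`ρ⁻¹ ≤ C (1 + |z|)^k / |δ(z)|`. [cite: SGA1, Exp. XII Thm. 5.1 (proof, part 2)] -/
theorem exists_radius (δ : MvPolynomial ι ℂ) :
    ∃ C : ℝ, 0 < C ∧ ∃ k : ℕ, ∀ z : ι → ℂ, eval z δ ≠ 0 → ∃ ρ : ℝ, 0 < ρ ∧ ρ ≤ 1 ∧
      ball z (2 * ρ) ⊆ {w | eval w δ ≠ 0} ∧ ρ⁻¹ ≤ C * (1 + ‖z‖) ^ k / ‖eval z δ‖ := by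
  obtain ⟨CL, hCL, kL, hL⟩ := exists_norm_eval_sub_le δ
  obtain ⟨Cδ, hCδ, kδ, hδ⟩ := exists_norm_eval_le_pow δ
  refine ⟨4 * CL + Cδ, by positivity, max kL kδ, fun z hz ↦ ?_⟩
  have hdz : 0 < ‖eval z δ‖ := norm_pos_iff.2 hz
  set A : ℝ := 4 * CL * (1 + ‖z‖) ^ kL with hA
  have hA0 : 0 < A := by positivity
  set ρ : ℝ := min 1 (‖eval z δ‖ / A) with hρ
  have hρ0 : 0 < ρ := lt_min one_pos (div_pos hdz hA0)
  have hρ1 : ρ ≤ 1 := min_le_left _ _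
  have hρA : ρ * A ≤ ‖eval z δ‖ := by
    have := min_le_right 1 (‖eval z δ‖ / A)
    rw [← hρ] at this
    calc ρ * A ≤ ‖eval z δ‖ / A * A := mul_le_mul_of_nonneg_right this hA0.le
      _ = ‖eval z δ‖ := div_mul_cancel₀ _ hA0.ne'
  refine ⟨ρ, hρ0, hρ1, fun w hw h0 ↦ ?_, ?_⟩
  · -- on `B(z, 2ρ)`, `|δ(w) - δ(z)| < |δ(z)|`
    rw [mem_ball, dist_eq_norm] at hw
    have hwz2 : ‖w - z‖ ≤ 2 := by nlinarith
    have h1 := hL z w hwz2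
    rw [h0, zero_sub, norm_neg] at h1
    have h2 : CL * (1 + ‖z‖) ^ kL * ‖w - z‖ < CL * (1 + ‖z‖) ^ kL * (2 * ρ) :=
      mul_lt_mul_of_pos_left hw (by positivity)
    nlinarith
  · -- `ρ⁻¹ ≤ 1 + A/|δ(z)| ≤ (4 CL + Cδ)(1 + |z|)^k / |δ(z)|`
    have hinv : ρ⁻¹ ≤ 1 + A / ‖eval z δ‖ := by
      rcases le_total 1 (‖eval z δ‖ / A) with hle | hle
      · rw [hρ, min_eq_left hle, inv_one]
        linarith [div_nonneg hA0.le hdz.le]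
      · rw [hρ, min_eq_right hle, inv_div]
        linarith
    refine hinv.trans ?_
    rw [le_div_iff₀ hdz, add_mul, one_mul, div_mul_cancel₀ _ hdz.ne']
    have h1 : ‖eval z δ‖ ≤ Cδ * (1 + ‖z‖) ^ max kL kδ :=
      (hδ z).trans (mul_le_mul_of_nonneg_left (one_add_norm_pow_le_pow z (le_max_right kL kδ)) hCδ.le)
    have h2 : A ≤ 4 * CL * (1 + ‖z‖) ^ max kL kδ :=
      mul_le_mul_of_nonneg_left (one_add_norm_pow_le_pow z (le_max_left kL kδ)) (by positivity)
    nlinarith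

end MvPolynomial
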